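import Literature.Claims.NS.Ramm2024
import Literature.Analysis.UnboundedOperators.HeatFlowCalculus
import Literature.Analysis.FluidPDE.TaoLocalisation
import HarnessLib

/-!
# NS-claims map (cell `ns-claims`, D-0090), claim C04 `Ramm2024`, part B: the two witness-side bounds

Typed skeleton `Literature.Claims.NS.Ramm2024` (A. G. Ramm, Modern Math. Methods 2 (2024) 19–26). Second of
three files of ns-claims-refuter-2's kernel refutation of Step 3 (`Step3_hyperSingularIneq`, (1.19) p. 22 ≡
(1.29) p. 23); split for the gate's 400-line cap; filed for the author by the cell's salvage prover under
interim convention (b), content unchanged. THIS PART (analysis written by ns-claims-typist-4 as hand-over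
support material `RammKit.lean` v3, adopted verbatim up to naming), for the skeleton's
`b(t) = (2π)^{−3/2}‖∇v(·,t)‖₂` and `b₀(t) = (2π)^{−3/2}‖∇e^{νtΔ}v₀‖₂`:
* (W3) `b₀_le`: `b₀ ν u₀ t ≤ (2π)^{−3/2}(gradNorm u₀).toReal` for all `t > 0` — derivatives commute with
  the heat flow (`fderiv_heatExtension_apply_eq_heatExtension_fderiv`) and `e^{sΔ}` contracts `L²`
  (`eLpNorm_heatExtension_le_holds`), for smooth rapidly decaying `u₀`;
* (W2) `b_lower_bound`: if `u` is smooth on `[0,∞) × ℝ³` and `b u 0 ≠ 0`, then `b u t ≥ β > 0` on some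
  `(0,δ)` wherever `gradNorm (u t)` is finite — Fatou at `t = 0⁺` for the continuous integrand
  `Σⱼ‖∂ⱼu(t,x)‖²` (slices of a `C^∞` map on the closed half-space).
Part A: `SoloRefuteRamm2024Laplace.lean`; part C: `SoloRefuteRamm2024.lean` (witness and verdict).
Axioms: `propext`, `Classical.choice`, `Quot.sound` only.
WHAT THIS IS NOT: not a claim about NS regularity or blow-up; not a claim about any author beyond the
typed locator.
-/

-- The summit's canonical theorem namespace repeats the summit name (single-conjunct summit).
set_option linter.dupNamespace false

noncomputable section

open MeasureTheory Set Filter Real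
open scoped Topology ENNReal ContDiff

namespace Summit.NavierStokesRegularity.NavierStokesRegularity.Theorems.Ramm2024

open Literature.Claims.NS.Ramm2024 Literature.Analysis.FluidPDE Literature.Analysis.UnboundedOperators

/-! ### (W3) The free heat flow does not increase the gradient norm -/

variable {u₀ : EuclideanSpace ℝ (Fin 3) → EuclideanSpace ℝ (Fin 3)}

/-- A smooth rapidly decreasing field is in `L²`. -/
theorem memLp_two_of_decay (hsm : ContDiff ℝ ∞ u₀) (hdec : HasRapidSpatialDecay u₀) :
    MemLp u₀ 2 volume := by
  refine ⟨hsm.continuous.aestronglyMeasurable, ?_⟩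
  rw [eLpNorm_lt_top_iff_lintegral_rpow_enorm_lt_top two_ne_zero ENNReal.ofNat_ne_top]
  have h := hdec.lintegral_enorm_iteratedFDeriv_sq_lt_top (μ := volume) 0
  simp only [ENNReal.toReal_ofNat]
  have h2 : ((2 : ℕ) : ℝ) = (2 : ℝ) := by norm_num
  have : (fun x => ‖u₀ x‖ₑ ^ (2 : ℝ)) = fun x => ‖iteratedFDeriv ℝ 0 u₀ x‖ₑ ^ 2 := by
    funext x
    rw [← h2, ENNReal.rpow_natCast, ← ofReal_norm, ← ofReal_norm, norm_iteratedFDeriv_zero]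
  rw [this]
  exact h

/-- The partial derivatives of a smooth rapidly decreasing field are in `L²`. -/
theorem memLp_two_partial (hsm : ContDiff ℝ ∞ u₀) (hdec : HasRapidSpatialDecay u₀)
    (e : EuclideanSpace ℝ (Fin 3)) (he : ‖e‖ ≤ 1) :
    MemLp (fun x => fderiv ℝ u₀ x e) 2 volume := by
  have hcont : Continuous fun x => fderiv ℝ u₀ x e :=
    (hsm.continuous_fderiv (by simp)).clm_apply continuous_const
  refine ⟨hcont.aestronglyMeasurable, ?_⟩
  rw [eLpNorm_lt_top_iff_lintegral_rpow_enorm_lt_top two_ne_zero ENNReal.ofNat_ne_top]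
  have h := hdec.lintegral_enorm_iteratedFDeriv_sq_lt_top (μ := volume) 1
  simp only [ENNReal.toReal_ofNat]
  refine lt_of_le_of_lt (lintegral_mono fun x => ?_) h
  have hpt : ‖fderiv ℝ u₀ x e‖ₑ ≤ ‖iteratedFDeriv ℝ 1 u₀ x‖ₑ := by
    rw [← ofReal_norm, ← ofReal_norm, norm_iteratedFDeriv_one]
    refine ENNReal.ofReal_le_ofReal ?_
    calc ‖fderiv ℝ u₀ x e‖ ≤ ‖fderiv ℝ u₀ x‖ * ‖e‖ := ContinuousLinearMap.le_opNorm _ _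
      _ ≤ ‖fderiv ℝ u₀ x‖ * 1 := by gcongr
      _ = ‖fderiv ℝ u₀ x‖ := mul_one _
  have h2 : ((2 : ℕ) : ℝ) = (2 : ℝ) := by norm_num
  calc ‖fderiv ℝ u₀ x e‖ₑ ^ (2 : ℝ) ≤ ‖iteratedFDeriv ℝ 1 u₀ x‖ₑ ^ (2 : ℝ) :=
        ENNReal.rpow_le_rpow hpt (by norm_num)
    _ = ‖iteratedFDeriv ℝ 1 u₀ x‖ₑ ^ 2 := by rw [← h2, ENNReal.rpow_natCast]

/-- The basis vectors `eⱼ = EuclideanSpace.single j 1` have norm `1`. -/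
theorem norm_single_one (j : Fin 3) : ‖(EuclideanSpace.single j (1 : ℝ))‖ = 1 := by
  simp

/-- `gradNorm u₀ < ⊤` for smooth rapidly decreasing `u₀`. -/
theorem gradNorm_lt_top (hsm : ContDiff ℝ ∞ u₀) (hdec : HasRapidSpatialDecay u₀) :
    gradNorm u₀ < ⊤ := by
  have hsq : ∀ g : EuclideanSpace ℝ (Fin 3) → EuclideanSpace ℝ (Fin 3),
      ∫⁻ x, ‖g x‖ₑ ^ 2 = eLpNorm g 2 volume ^ 2 := fun g => by
    rw [eLpNorm_eq_lintegral_rpow_enorm_toReal two_ne_zero ENNReal.ofNat_ne_top]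
    simp only [ENNReal.toReal_ofNat, one_div]
    rw [← ENNReal.rpow_natCast, ← ENNReal.rpow_mul]
    norm_num
  unfold gradNorm
  refine ENNReal.rpow_lt_top_of_nonneg (by norm_num) (ne_of_lt ?_)
  rw [lintegral_finsetSum' _ (fun j _ => ?_)]
  · refine ENNReal.sum_lt_top.mpr fun j _ => ?_
    rw [hsq]
    exact ENNReal.pow_lt_top (memLp_two_partial hsm hdec _ (norm_single_one j).le).2
  · exact ((memLp_two_partial hsm hdec _ (norm_single_one j).le).1.enorm.pow_const 2)

/-- **Heat-flow gradient contraction**: `gradNorm (e^{νtΔ}u₀) ≤ gradNorm u₀` for `t > 0`. -/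
theorem gradNorm_heatTest_le {ν : ℝ} (hν : 0 < ν) (hsm : ContDiff ℝ ∞ u₀)
    (hdec : HasRapidSpatialDecay u₀) {t : ℝ} (ht : 0 < t) :
    gradNorm (heatTest ν u₀ t) ≤ gradNorm u₀ := by
  have hs : 0 < ν * t := mul_pos hν ht
  have hflow : heatTest ν u₀ t = heatExtension u₀ (ν * t) := by
    unfold heatTest; exact heatFlow_of_pos u₀ hs
  have h2 : (1 : ℝ≥0∞) ≤ 2 := by norm_num
  have hL2 := memLp_two_of_decay hsm hdec
  have hsq : ∀ g : EuclideanSpace ℝ (Fin 3) → EuclideanSpace ℝ (Fin 3),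
      ∫⁻ x, ‖g x‖ₑ ^ 2 = eLpNorm g 2 volume ^ 2 := fun g => by
    rw [eLpNorm_eq_lintegral_rpow_enorm_toReal two_ne_zero ENNReal.ofNat_ne_top]
    simp only [ENNReal.toReal_ofNat, one_div]
    rw [← ENNReal.rpow_natCast, ← ENNReal.rpow_mul]
    norm_num
  unfold gradNorm
  refine ENNReal.rpow_le_rpow ?_ (by norm_num)
  -- commute ∂ⱼ with the heat flow, pointwise
  have hcomm : ∀ (j : Fin 3) (x : EuclideanSpace ℝ (Fin 3)),
      fderiv ℝ (heatTest ν u₀ t) x (EuclideanSpace.single j (1 : ℝ)) =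
        heatExtension (fun z => fderiv ℝ u₀ z (EuclideanSpace.single j (1 : ℝ))) (ν * t) x := by
    intro j x
    rw [hflow]
    exact fderiv_heatExtension_apply_eq_heatExtension_fderiv (hsm.of_le (by exact_mod_cast le_top)) hL2 h2
      (memLp_two_partial hsm hdec _ (norm_single_one j).le) h2 hs x
  simp_rw [hcomm]
  have hmeas : ∀ j : Fin 3, AEMeasurable (fun x => ‖heatExtension
      (fun z => fderiv ℝ u₀ z (EuclideanSpace.single j (1 : ℝ))) (ν * t) x‖ₑ ^ 2) volume :=
    fun j => (memLp_heatExtension_holds (memLp_two_partial hsm hdec _ (norm_single_one j).le)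
      h2 hs).1.enorm.pow_const 2
  have hmeas0 : ∀ j : Fin 3,
      AEMeasurable (fun x => ‖fderiv ℝ u₀ x (EuclideanSpace.single j (1 : ℝ))‖ₑ ^ 2) volume :=
    fun j => (memLp_two_partial hsm hdec _ (norm_single_one j).le).1.enorm.pow_const 2
  rw [lintegral_finsetSum' _ (fun j _ => hmeas j), lintegral_finsetSum' _ (fun j _ => hmeas0 j)]
  refine Finset.sum_le_sum fun j _ => ?_
  rw [hsq, hsq]
  gcongr
  exact eLpNorm_heatExtension_le_holds (memLp_two_partial hsm hdec _ (norm_single_one j).le) h2 hs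

/-- **(W3)** `b₀ ν u₀ t ≤ (2π)^{-3/2} · (gradNorm u₀).toReal` for all `t > 0`. -/
theorem b₀_le (hsm : ContDiff ℝ ∞ u₀) (hdec : HasRapidSpatialDecay u₀) {ν : ℝ} (hν : 0 < ν) :
    ∃ B : ℝ, ∀ t : ℝ, 0 < t → b₀ ν u₀ t ≤ B := by
  refine ⟨(2 * Real.pi) ^ (-(3 : ℝ) / 2) * (gradNorm u₀).toReal, fun t ht => ?_⟩
  unfold b₀
  refine mul_le_mul_of_nonneg_left ?_ (Real.rpow_nonneg (by positivity) _)
  exact ENNReal.toReal_mono (gradNorm_lt_top hsm hdec).ne (gradNorm_heatTest_le hν hsm hdec ht)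

/-! ## (W2) Lower semicontinuity of the gradient norm at `t = 0⁺` for fields smooth on the closed
half-space: if `b u 0 ≠ 0` then `b u t ≥ β > 0` on some `(0,δ)` (wherever `gradNorm (u t)` is finite). -/

section W2

open Filter Topology

variable {u : ℝ → EuclideanSpace ℝ (Fin 3) → EuclideanSpace ℝ (Fin 3)}

/-- Slices of a field smooth on `[0,∞) × ℝ³`: for `t ≥ 0`, `x ↦ u t x` is differentiable with
derivative the restriction of the space-time derivative to the spatial directions. -/
theorem hasFDerivAt_slice (hu : IsSmoothOnHalfSpace u) {t : ℝ} (ht : 0 ≤ t)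
    (x : EuclideanSpace ℝ (Fin 3)) :
    HasFDerivAt (u t) ((fderivWithin ℝ (Function.uncurry u) (Ici (0 : ℝ) ×ˢ univ) (t, x)).comp
      (ContinuousLinearMap.inr ℝ ℝ (EuclideanSpace ℝ (Fin 3)))) x := by
  have hd : DifferentiableWithinAt ℝ (Function.uncurry u) (Ici (0 : ℝ) ×ˢ univ) (t, x) :=
    (hu.differentiableOn (by simp)) (t, x) ⟨ht, trivial⟩
  have h1 : HasFDerivWithinAt (Function.uncurry u)
      (fderivWithin ℝ (Function.uncurry u) (Ici (0 : ℝ) ×ˢ univ) (t, x)) (Ici (0 : ℝ) ×ˢ univ)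
      (t, x) := hd.hasFDerivWithinAt
  have h2 : HasFDerivWithinAt (fun y : EuclideanSpace ℝ (Fin 3) => (t, y))
      (ContinuousLinearMap.inr ℝ ℝ (EuclideanSpace ℝ (Fin 3))) univ x :=
    (hasFDerivAt_prodMk_right t x).hasFDerivWithinAt
  have h3 := h1.comp x h2 (fun y _ => ⟨ht, trivial⟩)
  exact h3.hasFDerivAt_of_univ

/-- The slice formula: `∂ⱼ(u t)(x) = D(uncurry u)(t,x)(0, eⱼ)` for `t ≥ 0`. -/
theorem fderiv_slice_apply (hu : IsSmoothOnHalfSpace u) {t : ℝ} (ht : 0 ≤ t)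
    (x v : EuclideanSpace ℝ (Fin 3)) :
    fderiv ℝ (u t) x v = fderivWithin ℝ (Function.uncurry u) (Ici (0 : ℝ) ×ˢ univ) (t, x) (0, v) := by
  rw [(hasFDerivAt_slice hu ht x).fderiv]
  simp

/-- Pointwise continuity of `t ↦ ∂ⱼ u(t,x)` at `t = 0⁺`. -/
theorem tendsto_fderiv_slice (hu : IsSmoothOnHalfSpace u) (x v : EuclideanSpace ℝ (Fin 3)) :
    Tendsto (fun t => fderiv ℝ (u t) x v) (𝓝[>] 0) (𝓝 (fderiv ℝ (u 0) x v)) := by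
  have hS : UniqueDiffOn ℝ (Ici (0 : ℝ) ×ˢ (univ : Set (EuclideanSpace ℝ (Fin 3)))) :=
    (uniqueDiffOn_Ici 0).prod uniqueDiffOn_univ
  have hcont := hu.continuousOn_fderivWithin hS (by simp)
  have hpath : Tendsto (fun t : ℝ => (t, x)) (𝓝[>] 0)
      (𝓝[Ici (0 : ℝ) ×ˢ univ] ((0 : ℝ), x)) := by
    refine tendsto_nhdsWithin_iff.mpr ⟨?_, ?_⟩
    · have : Tendsto (fun t : ℝ => (t, x)) (𝓝 0) (𝓝 ((0 : ℝ), x)) :=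
        (continuous_id.prodMk continuous_const).tendsto 0
      exact this.mono_left nhdsWithin_le_nhds
    · filter_upwards [self_mem_nhdsWithin] with t ht
      exact Set.mk_mem_prod (Set.mem_Ici.mpr (le_of_lt ht)) (Set.mem_univ _)
  have hD := (hcont ((0 : ℝ), x)
    (Set.mk_mem_prod (Set.mem_Ici.mpr (le_refl _)) (Set.mem_univ _))).tendsto.comp hpath
  have hDv := ((ContinuousLinearMap.apply ℝ (EuclideanSpace ℝ (Fin 3))
      ((0 : ℝ), v)).continuous.tendsto _).comp hD
  rw [fderiv_slice_apply hu (le_refl 0) x v]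
  refine Tendsto.congr' ?_ hDv
  filter_upwards [self_mem_nhdsWithin] with t ht
  simp only [Function.comp_apply, ContinuousLinearMap.apply_apply]
  rw [fderiv_slice_apply hu (le_of_lt ht) x v]

/-- The integrand of `gradNorm`. -/
noncomputable def gradIntegrand (u : ℝ → EuclideanSpace ℝ (Fin 3) → EuclideanSpace ℝ (Fin 3)) (t : ℝ)
    (x : EuclideanSpace ℝ (Fin 3)) : ℝ≥0∞ :=
  ∑ j : Fin 3, ‖fderiv ℝ (u t) x (EuclideanSpace.single j (1 : ℝ))‖ₑ ^ 2

/-- The integrand of `gradNorm (u t)` is measurable (derivatives of arbitrary functions are measurable). -/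
theorem measurable_gradIntegrand (u : ℝ → EuclideanSpace ℝ (Fin 3) → EuclideanSpace ℝ (Fin 3))
    (t : ℝ) : Measurable (gradIntegrand u t) := by
  unfold gradIntegrand
  refine Finset.measurable_sum _ fun j _ => ?_
  exact ((measurable_fderiv_apply_const ℝ (u t) _).enorm).pow_const 2

/-- `gradNorm (u t) = (∫⁻ gradIntegrand u t)^{1/2}` (definitional). -/
theorem gradNorm_slice_eq (u : ℝ → EuclideanSpace ℝ (Fin 3) → EuclideanSpace ℝ (Fin 3)) (t : ℝ) :
    gradNorm (u t) = (∫⁻ x, gradIntegrand u t x) ^ (1 / 2 : ℝ) := rfl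

/-- **Fatou at `t = 0⁺`**: `∫ Σⱼ‖∂ⱼu(0)‖² ≤ liminf_{t→0⁺} ∫ Σⱼ‖∂ⱼu(t)‖²`. -/
theorem lintegral_gradIntegrand_le_liminf (hu : IsSmoothOnHalfSpace u) :
    ∫⁻ x, gradIntegrand u 0 x ≤ liminf (fun t => ∫⁻ x, gradIntegrand u t x) (𝓝[>] 0) := by
  have hpt : ∀ x, Tendsto (fun t => gradIntegrand u t x) (𝓝[>] 0) (𝓝 (gradIntegrand u 0 x)) := by
    intro x
    unfold gradIntegrand
    refine tendsto_finsetSum _ fun j _ => ?_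
    exact (((ENNReal.continuous_pow 2).comp continuous_enorm).tendsto _).comp
      (tendsto_fderiv_slice hu x _)
  calc ∫⁻ x, gradIntegrand u 0 x = ∫⁻ x, liminf (fun t => gradIntegrand u t x) (𝓝[>] 0) :=
        lintegral_congr fun x => ((hpt x).liminf_eq).symm
    _ ≤ liminf (fun t => ∫⁻ x, gradIntegrand u t x) (𝓝[>] 0) :=
        lintegral_liminf_le' fun t => (measurable_gradIntegrand u t).aemeasurable

/-- **(W2)** If `u` is smooth on `[0,∞) × ℝ³` and `b u 0 ≠ 0`, then for some `β, δ > 0`: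
`β ≤ b u t` for every `t ∈ (0,δ)` at which `gradNorm (u t)` is finite. -/
theorem b_lower_bound (hu : IsSmoothOnHalfSpace u) (hb : b u 0 ≠ 0) :
    ∃ β δ : ℝ, 0 < β ∧ 0 < δ ∧ ∀ t ∈ Ioo (0 : ℝ) δ, gradNorm (u t) ≠ ⊤ → β ≤ b u t := by
  set G0 : ℝ≥0∞ := ∫⁻ x, gradIntegrand u 0 x with hG0def
  have hκ : 0 < (2 * Real.pi) ^ (-(3 : ℝ) / 2) := Real.rpow_pos_of_pos (by positivity) _
  -- `b u 0 ≠ 0` gives `0 < G0 < ⊤`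
  have hroot : (G0 ^ (1 / 2 : ℝ)).toReal ≠ 0 := by
    intro h
    apply hb
    unfold b
    rw [gradNorm_slice_eq, ← hG0def, h, mul_zero]
  have hG0ne : G0 ≠ 0 := by
    intro h; apply hroot; rw [h, ENNReal.zero_rpow_of_pos (by norm_num)]; rfl
  have hG0top : G0 ≠ ⊤ := by
    intro h; apply hroot; rw [h, ENNReal.top_rpow_of_pos (by norm_num)]; rfl
  -- Fatou: eventually `G0/2 < ∫ gradIntegrand u t`
  have hlim := lintegral_gradIntegrand_le_liminf hu
  have hhalf : G0 / 2 < liminf (fun t => ∫⁻ x, gradIntegrand u t x) (𝓝[>] 0) :=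
    lt_of_lt_of_le (ENNReal.half_lt_self hG0ne hG0top) hlim
  have hev := eventually_lt_of_lt_liminf hhalf
  obtain ⟨δ, hδ, hsub⟩ := mem_nhdsGT_iff_exists_Ioo_subset.mp hev
  refine ⟨(2 * Real.pi) ^ (-(3 : ℝ) / 2) * ((G0 / 2) ^ (1 / 2 : ℝ)).toReal, δ, ?_, hδ, ?_⟩
  · refine mul_pos hκ (ENNReal.toReal_pos ?_ ?_)
    · exact fun h => (ENNReal.div_ne_zero.mpr ⟨hG0ne, by norm_num⟩)
        ((ENNReal.rpow_eq_zero_iff_of_pos (by norm_num)).mp h)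
    · exact ENNReal.rpow_ne_top_of_nonneg (by norm_num) (ENNReal.div_ne_top hG0top (by norm_num))
  · intro t ht hfin
    have hlt : G0 / 2 < ∫⁻ x, gradIntegrand u t x := hsub ht
    unfold b
    refine mul_le_mul_of_nonneg_left ?_ hκ.le
    rw [gradNorm_slice_eq] at hfin ⊢
    exact ENNReal.toReal_mono hfin (ENNReal.rpow_le_rpow hlt.le (by norm_num))

end W2

end Summit.NavierStokesRegularity.NavierStokesRegularity.Theorems.Ramm2024

end

-- WHAT THIS IS NOT: not a claim about NS regularity or blow-up; not a claim about any author beyond the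
-- typed locator.
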